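import Summits.QuantumFields.BalabanUV.T4Continuum.Support.VariationalCovariantH2
import Summits.QuantumFields.BalabanUV.T4Continuum.Support.VariationalCovariantScalarForm

/-!
# T⁴ programme, spine node NE2 (U1a), lane P2 — LEAF REG⁺ AT THE MINIMISER (lattice units): the covariant H²-functional of the constrained
# minimiser is bounded by the unit datum through the Euler–Lagrange equation, `ρ(Hμ) ≤ 2(c_Q/c²)‖X‖²·Σ|μ|² + (d a_f)²·Σ|Hμ|² + 2d a_f·F(Hμ)`
# (`t4/skeletons/NE2-t4-ne2-p2.md` v0.8 §2.C leaf REG⁺; cell `pub-balaban`, row NE2 co-owner #2, lineage t4-ne2-p2 gen 10)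

HONEST FRAMING (T4-DAG p. 1).  Rung (B)+1 only — NOT infinite volume, NOT a mass gap, NOT Clay.  NE2 is NOT IN PRINT and NOT proved here.  MODEL
LEVEL ([folklore] linear algebra): the bridge `(Dmat)ᴴ·Dmat = Δ_R` between the two matrix presentations (`VariationalCovariantScalarForm.Dmat`,
`VariationalCovariantH2.Lap`), `Σ|Qᴴv|² = c_Q·Σ|v|²` for orthogonal rows, **`rho_le_of_source`** (any field whose `c·Δ_R` is a lifted source `Qᴴv`
has `ρ ≤ 2(c_Q/c²)Σ|v|² + (d a_f)²Σ|f|² + 2d a_f F(f)`, from `VariationalCovariantH2.h2_estimate`), and **`rho_minimiser_le`** (the source of the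
constrained minimiser is `Qᴴ X μ` by `VariationalKKT.euler_lagrange`, `X = effForm`).  The physical-unit repackaging `(n⁴/n^d)·ρ ≤ C_R(Sc + Σ|μ|²)`
(with `‖X‖ ≤ Λ` from `ub_tower` and `Σ|Hμ|²` by P⁺) is bookkeeping left to the assembly.  COMPLEMENTARY to the NE2 swarm's
`Support/VariationalCovariantRegularity` (leaf prover 09: the Laplacian-form bound `‖Δ_R H_kμ‖² ≤ Λ·Sc(H_kμ)` by UB⁺-duality WITHOUT KKT) — here the
full H² functional `ρ` (all second covariant differences, needed by ONE⁺'s interpolant defect) is controlled.  Nothing printed is a hypothesis; no `def … : Prop` fact; no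
`sorry`; axioms standard.  HONEST DEPENDENCY (cell, verbatim): continuum YM on T⁴ ⇐ BetaPertH ∧ nine spine estimates (0/9 proved); BetaPertH ⇐ (D1) ∧
(D4) ∧ CAP+tail; G-an2-4 gates asym, D1 and NE2/3/4.
-/

noncomputable section

open scoped BigOperators ComplexConjugate Matrix Matrix.Norms.L2Operator

namespace Summit.QuantumFields.BalabanUV.T4Continuum.VariationalCovariantRegLink

open Finset
open Literature.MathematicalPhysics.QuantumFieldTheory.Balaban1983to89
open Literature.MathematicalPhysics.QuantumFieldTheory.Balaban1983to89.B5Prop11Plancherel (Tor unitVec)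
open Literature.MathematicalPhysics.QuantumFieldTheory.Balaban1983to89.B5Prop11Lower (nsq nsq_nonneg nsq_mulVec_le star_dotProduct_self)
open Summit.QuantumFields.BalabanUV.T4Continuum.CoerciveInverseTower (Coercive isUnit_of_coercive)
open Summit.QuantumFields.BalabanUV.T4Continuum.VariationalCovariantFederbush (cD dirU)
open Summit.QuantumFields.BalabanUV.T4Continuum.VariationalCovariantH2 (Tm Dm Lap rho dirF plaq h2_estimate Tm_conjTranspose_mulVec Dm_mulVec)
open Summit.QuantumFields.BalabanUV.T4Continuum.VariationalCovariantScalarForm (Dmat Smat Dmat_mulVec)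
open Summit.QuantumFields.BalabanUV.T4Continuum.VariationalKKT (Sa Kmat effForm Hmin euler_lagrange blockSpin_eq_quadForm)
open Summit.QuantumFields.BalabanUV.T4Continuum.BalabanHardMinimizer (star_conjTranspose_mulVec_dotProduct)

variable {d : ℕ} (N : Fin d → ℕ) [∀ μ, NeZero (N μ)] (R : Tor N → Fin d → ℂ)

/-! ## §1 The bridge between the two matrix presentations -/

/-- `(Dmatᴴ g)(x) = Σ_μ (conj R(x−e_μ,μ)·g(x−e_μ,μ) − g(x,μ))`. [folklore] -/
theorem Dmat_conjTranspose_mulVec (g : Tor N × Fin d → ℂ) (x : Tor N) :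
    ((Dmat N R)ᴴ *ᵥ g) x = ∑ μ, ((starRingEnd ℂ) (R (x - unitVec N μ) μ) * g (x - unitVec N μ, μ) - g (x, μ)) := by
  simp only [Matrix.mulVec, dotProduct, Matrix.conjTranspose_apply, Dmat, Matrix.of_apply, star_sub, sub_mul, Finset.sum_sub_distrib]
  rw [Fintype.sum_prod_type, Fintype.sum_prod_type]
  congr 1
  · rw [Finset.sum_comm]
    refine Finset.sum_congr rfl fun μ _ => ?_
    rw [Finset.sum_eq_single (x - unitVec N μ)]
    · rw [if_pos (sub_add_cancel x (unitVec N μ)).symm, Complex.star_def]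
    · intro y _ hy
      rw [if_neg, star_zero, zero_mul]
      intro h; apply hy; rw [h]; abel
    · intro h; exact absurd (Finset.mem_univ _) h
  · rw [Finset.sum_comm]
    refine Finset.sum_congr rfl fun μ _ => ?_
    rw [Finset.sum_eq_single x]
    · rw [if_pos rfl, star_one, one_mul]
    · intro y _ hy
      rw [if_neg (Ne.symm hy), star_zero, zero_mul]
    · intro h; exact absurd (Finset.mem_univ _) h

/-- **the bridge**: `Dmatᴴ·(Dmat f) = Δ_R f`. [folklore] -/
theorem gram_Dmat_mulVec (f : Tor N → ℂ) : (Dmat N R)ᴴ *ᵥ (Dmat N R *ᵥ f) = Lap N R *ᵥ f := by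
  funext x
  rw [Dmat_conjTranspose_mulVec, Lap, Matrix.sum_mulVec, Finset.sum_apply]
  refine Finset.sum_congr rfl fun μ _ => ?_
  have hD : (Dm N R μ)ᴴ = (Tm N R μ)ᴴ - 1 := by rw [Dm, Matrix.conjTranspose_sub, Matrix.conjTranspose_one]
  rw [← Matrix.mulVec_mulVec, hD, Matrix.sub_mulVec, Matrix.one_mulVec, Pi.sub_apply, Tm_conjTranspose_mulVec, Dm_mulVec, Dm_mulVec]
  simp only [Dmat_mulVec]

/-- `Smat f = c·Δ_R f`. [folklore] -/
theorem Smat_mulVec (c : ℝ) (f : Tor N → ℂ) : Smat N R c *ᵥ f = (c : ℂ) • (Lap N R *ᵥ f) := by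
  rw [Smat, Matrix.smul_mulVec, ← Matrix.mulVec_mulVec, gram_Dmat_mulVec]

/-! ## §2 REG⁺ from a lifted source -/

variable {κ : Type*} [Fintype κ] [DecidableEq κ]

/-- orthogonal rows: `Σ|Qᴴ v|² = c_Q·Σ|v|²`. [folklore] -/
theorem nsq_conjTranspose_mulVec {Qm : Matrix κ (Tor N) ℂ} {cQ : ℝ} (hQQ : Qm * Qmᴴ = (cQ : ℂ) • 1) (v : κ → ℂ) :
    nsq (Qmᴴ *ᵥ v) = cQ * nsq v := by
  have h1 : star (Qmᴴ *ᵥ v) ⬝ᵥ (Qmᴴ *ᵥ v) = star v ⬝ᵥ ((Qm * Qmᴴ) *ᵥ v) := by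
    rw [← Matrix.mulVec_mulVec, star_conjTranspose_mulVec_dotProduct]
  rw [hQQ, Matrix.smul_mulVec, Matrix.one_mulVec, dotProduct_smul, star_dotProduct_self, star_dotProduct_self] at h1
  have h2 := congrArg Complex.re h1
  simpa [Complex.smul_re] using h2

/-- **REG⁺ FROM A LIFTED SOURCE**: if `Smat f = Qᴴ v` (the field's `c·Δ_R` is a lifted unit-lattice source) then
`ρ(f) ≤ 2(c_Q/c²)·Σ|v|² + (d a_f)²·Σ|f|² + 2d a_f·F(f)`. [folklore] -/
theorem rho_le_of_source (hR : ∀ y μ, ‖R y μ‖ = 1) {af : ℝ} (haf0 : 0 ≤ af) (haf : ∀ y μ ν, ‖plaq N R y μ ν‖ ≤ af)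
    {Qm : Matrix κ (Tor N) ℂ} {cQ c : ℝ} (hc : 0 < c) (hQQ : Qm * Qmᴴ = (cQ : ℂ) • 1) (f : Tor N → ℂ) (v : κ → ℂ)
    (hsrc : Smat N R c *ᵥ f = Qmᴴ *ᵥ v) :
    rho N R f ≤ 2 * (cQ / c ^ 2 * nsq v) + (d * af) ^ 2 * nsq f + 2 * d * af * dirF N R f := by
  have hLap : Lap N R *ᵥ f = ((c : ℂ)⁻¹) • (Qmᴴ *ᵥ v) := by
    rw [← hsrc, Smat_mulVec, smul_smul, inv_mul_cancel₀ (by exact_mod_cast hc.ne'), one_smul]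
  have hn : nsq (Lap N R *ᵥ f) = cQ / c ^ 2 * nsq v := by
    rw [hLap]
    have : nsq (((c : ℂ)⁻¹) • (Qmᴴ *ᵥ v)) = (c⁻¹) ^ 2 * nsq (Qmᴴ *ᵥ v) := by
      unfold nsq
      rw [Finset.mul_sum]
      refine Finset.sum_congr rfl fun i _ => ?_
      rw [Pi.smul_apply, smul_eq_mul, norm_mul, norm_inv, Complex.norm_real, Real.norm_eq_abs, abs_of_pos hc, mul_pow]
    rw [this, nsq_conjTranspose_mulVec N hQQ]
    field_simp
  have h := h2_estimate N R hR haf0 haf f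
  rw [hn] at h
  exact h

/-- **REG⁺ AT THE CONSTRAINED MINIMISER** (lattice units): under the hypotheses of `VariationalKKT.blockSpin_eq_quadForm` for `S = Smat`,
the minimiser `Hμ` has source `Qᴴ X μ` (`X = effForm`), hence `ρ(Hμ) ≤ 2(c_Q/c²)‖X‖²·Σ|μ|² + (d a_f)²·Σ|Hμ|² + 2d a_f·F(Hμ)`. [folklore] -/
theorem rho_minimiser_le (hR : ∀ y μ, ‖R y μ‖ = 1) {af : ℝ} (haf0 : 0 ≤ af) (haf : ∀ y μ ν, ‖plaq N R y μ ν‖ ≤ af)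
    {Qm : Matrix κ (Tor N) ℂ} {cQ c a γ Λ : ℝ} (hc : 0 < c) (hcQ : 0 < cQ) (hγ : 0 < γ) (hΛ : 0 < Λ)
    (hQQ : Qm * Qmᴴ = (cQ : ℂ) • 1) (hS0 : ∀ f, 0 ≤ (star f ⬝ᵥ (Smat N R c *ᵥ f)).re)
    (hcoer : Coercive γ (Sa (Smat N R c) Qm a)) (hnorm : ‖Sa (Smat N R c) Qm a‖ ≤ Λ) (μ : κ → ℂ) :
    rho N R (Hmin (Smat N R c) Qm a μ)
      ≤ 2 * (cQ / c ^ 2 * (‖effForm (Smat N R c) Qm a‖ ^ 2 * nsq μ)) + (d * af) ^ 2 * nsq (Hmin (Smat N R c) Qm a μ)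
        + 2 * d * af * dirF N R (Hmin (Smat N R c) Qm a μ) := by
  have hSH : (Smat N R c)ᴴ = Smat N R c := VariationalCovariantScalarForm.Smat_conjTranspose N R c
  have hQH : Qm *ᵥ Hmin (Smat N R c) Qm a μ = μ := (blockSpin_eq_quadForm (a := a) hSH hS0 hcQ hγ hΛ hQQ hcoer hnorm μ).1
  have hEL := euler_lagrange (S := Smat N R c) (Q := Qm) (a := a) hγ hcoer μ
  -- the source: Smat H = Qᴴ (K⁻¹ μ − a μ) = Qᴴ (X μ)
  have hsrc : Smat N R c *ᵥ Hmin (Smat N R c) Qm a μ = Qmᴴ *ᵥ (effForm (Smat N R c) Qm a *ᵥ μ) := by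
    have e : Sa (Smat N R c) Qm a *ᵥ Hmin (Smat N R c) Qm a μ
        = Smat N R c *ᵥ Hmin (Smat N R c) Qm a μ + (a : ℂ) • (Qmᴴ *ᵥ μ) := by
      rw [Sa, Matrix.add_mulVec, Matrix.smul_mulVec, ← Matrix.mulVec_mulVec, hQH]
    rw [e] at hEL
    rw [effForm, Matrix.sub_mulVec, Matrix.smul_mulVec, Matrix.one_mulVec, Matrix.mulVec_sub, Matrix.mulVec_smul]
    exact eq_sub_of_add_eq hEL
  have h := rho_le_of_source N R hR haf0 haf hc hQQ _ _ hsrc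
  have hX : nsq (effForm (Smat N R c) Qm a *ᵥ μ) ≤ ‖effForm (Smat N R c) Qm a‖ ^ 2 * nsq μ := nsq_mulVec_le _ _
  have hpos : 0 ≤ cQ / c ^ 2 := by positivity
  nlinarith [h, mul_le_mul_of_nonneg_left hX hpos]

end Summit.QuantumFields.BalabanUV.T4Continuum.VariationalCovariantRegLink

end
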